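import Summits.CriticalPhenomena.PercolationContinuityZ3.Theorems.Transplant.PlanarSkeletonFrmQuasiDefs
import Summits.CriticalPhenomena.PercolationContinuityZ3.Theorems.Transplant.SkelFrmQuasiBChoiceDefs
import Summits.CriticalPhenomena.PercolationContinuityZ3.Theorems.Transplant.SkelFrmBChoiceDefs
import Summits.CriticalPhenomena.PercolationContinuityZ3.Theorems.Transplant.SkelFrmQuasiBParamsFineSize
import Summits.CriticalPhenomena.PercolationContinuityZ3.Theorems.Transplant.SkelFrmBParamsFineSize
import Summits.CriticalPhenomena.PercolationContinuityZ3.Theorems.Transplant.SkelNegBParamsSchedA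
import Summits.CriticalPhenomena.PercolationContinuityZ3.Theorems.Transplant.SkelFrmQuasi1ParamsLBL
import Summits.CriticalPhenomena.PercolationContinuityZ3.Theorems.Transplant.SkelFrmQuasiBParamsLF
import Summits.CriticalPhenomena.PercolationContinuityZ3.Theorems.Transplant.SkelFrmQuasiBParamsLFA
import HarnessLib
import Summits.CriticalPhenomena.PercolationContinuityZ3.Theorems.Transplant.SkelFrmBParamsSchedA
/-!
# GEN-Q PORT (WAVE-Q table v0.8 section 2, row G045, U-level L8; captain R-6/R-7 2026-08-27: carrier token swap `PlanarSkeletonFrmFrom ↦ PlanarSkeletonFrmQuasi`)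
# of the tree module «Transplant/SkelFrmFromBParamsSchedA» (sha256 104a86766e180925…) onto the quasi-step carrier `PlanarSkeletonFrmQuasi` (p507026): «SkelFrmQuasiBParamsSchedA»

ORIGINAL TITLE: N2 (frames-only node `SamePDropOfSkeletonFrmFrom₁`, OPEN) params column over `PlanarSkeletonFrm` — (ζ″) ledger, part Sched-A AT THE STAGGERED CENTRE:

builds on p205010 (kernel theorem, internal audit signed; external expert review pending) — nothing in this file uses p205010; NOTHING is claimed about any open node
((N3-b), the end state).  Lane `prim-bschramm`, seat `prim-bschramm-stmt` (gen 33; GEN-Q column pen; tool = captain gen-1 g4's port_genq.py R-14 --cone + p3-g30's T1 patch).  Helper file (`--supports stmt-CriticalPhenomena-4575 --as helper`).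
PORT RULES (U-wave r1–r4 re-used, GEN-Q hunk classes of p3-g29 #6136): declaration order, names and proof texts are those of «SkelFrmFromBParamsSchedA», byte-identical except
(i) the carrier token `PlanarSkeletonFrmFrom ↦ PlanarSkeletonFrmQuasi` in binders, `namespace`/`end` lines and qualified names (module names `SkelFrmFrom… ↦ SkelFrmQuasi…`
in imports of already-ported rows); (ii) `Φ.step ↦ Φ.qstep` with the called Steps lemma replaced by its `…Q`/`_q` twin and the cost `Φ.M` threaded (none in this file unless
listed below); (iii) `Φ.cyl_connected ↦ Φ.cyl_reach` readers (none unless listed); (iv) graph-ball radii / window floors ×`Φ.M` (none unless listed).  Carrier-free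
residents stay imported/exported from the original «SkelFrmBParamsSchedA» exactly as in the FrmFrom port.  Docstrings and citations are the original's.

-/

noncomputable section

open scoped Classical

namespace Summit.CriticalPhenomena.PercolationContinuityZ3.Theorems.Transplant

open Literature.Probability.Percolation Literature.Probability.LatticeModels SimpleGraph KNCells

namespace PlanarSkeletonFrmQuasi

namespace NegB

open SkelConc (Consts)
open BoxProdZ2 (ConcRadiiG)
open Literature.Probability.Percolation.KozmaNitzan.Cells (oth)
open Neg

section Sched

variable (κ : Consts) {V : Type} [DecidableEq V] [Countable V] {G : SimpleGraph V} [G.LocallyFinite] (Φ : PlanarSkeletonFrmQuasi G) (t : V)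
  (p : unitInterval) (D : Skelφ.StepI.DataNS V) (g f : ℕ) (c : Fin 2 → ℕ)

/-! ## §1 The lattice record of the (ζ′)/(ζ″) cells -/

/-- **THE LATTICE RECORD OF RECORD** `prFA := ⟨A, n_L, h_L, v_L, v_β, 20K·s₀, 20K·s₁, D_A⟩` (hp-8's `FinePrm`; `prFA.ψ φ′ t = NegB.fineA … φ′`). [this work] -/
def prFA (κ : Consts) {V : Type} [DecidableEq V] [Countable V] {G : SimpleGraph V} [G.LocallyFinite] (Φ : PlanarSkeletonFrmQuasi G) (t : V) (p : unitInterval) (D : Skelφ.StepI.DataNS V) (g : ℕ) (f : ℕ) : Skelφ.FinePrm where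
  A := Aof κ
  n := nL κ Φ t p D g f
  h := hL κ Φ t p D g f
  vα := vL κ Φ t p D g f
  vβ := vβL κ Φ t p D g f
  c₀ := 20 * ((fcellsA κ Φ t p D g f).K : ℤ) * (((fcellsA κ Φ t p D g f).s 0 : ℕ) : ℤ)
  c₁ := 20 * ((fcellsA κ Φ t p D g f).K : ℤ) * (((fcellsA κ Φ t p D g f).s 1 : ℕ) : ℤ)
  D := Skelφ.NegPrm.DofA (Aof κ) (nL κ Φ t p D g f) (hL κ Φ t p D g f) (ℓL κ Φ t p D g f) (vL κ Φ t p D g f)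

/-- The fields of `prFA` by `rfl`. [folklore] -/
theorem prFA_fields (κ : Consts) {V : Type} [DecidableEq V] [Countable V] {G : SimpleGraph V} [G.LocallyFinite] (Φ : PlanarSkeletonFrmQuasi G) (t : V) (p : unitInterval) (D : Skelφ.StepI.DataNS V) (g : ℕ) (f : ℕ) :
    (prFA κ Φ t p D g f).A = Aof κ ∧ (prFA κ Φ t p D g f).n = nL κ Φ t p D g f ∧ (prFA κ Φ t p D g f).h = hL κ Φ t p D g f ∧
      (prFA κ Φ t p D g f).vα = vL κ Φ t p D g f ∧ (prFA κ Φ t p D g f).vβ = vβL κ Φ t p D g f ∧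
      (prFA κ Φ t p D g f).c₀ = 20 * ((fcellsA κ Φ t p D g f).K : ℤ) * (((fcellsA κ Φ t p D g f).s 0 : ℕ) : ℤ) ∧
      (prFA κ Φ t p D g f).c₁ = 20 * ((fcellsA κ Φ t p D g f).K : ℤ) * (((fcellsA κ Φ t p D g f).s 1 : ℕ) : ℤ) ∧
      (prFA κ Φ t p D g f).D = Skelφ.NegPrm.DofA (Aof κ) (nL κ Φ t p D g f) (hL κ Φ t p D g f) (ℓL κ Φ t p D g f) (vL κ Φ t p D g f) :=
  ⟨rfl, rfl, rfl, rfl, rfl, rfl, rfl, rfl⟩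

-- GEN-Q (R-2, captain 2026-08-27): `PlanarSkeletonFrmFrom.NegB.prFA_ψ` is not in the used cone of the node top — not ported.

/-- `prFA.D = detD prFA.A prFA.n prFA.h prFA.vα prFA.vβ`. [folklore] -/
theorem prFA_D (κ : Consts) {V : Type} [DecidableEq V] [Countable V] {G : SimpleGraph V} [G.LocallyFinite] (Φ : PlanarSkeletonFrmQuasi G) (t : V) (p : unitInterval) (D : Skelφ.StepI.DataNS V) (g : ℕ) (f : ℕ) : (prFA κ Φ t p D g f).D =
    TwoAxis.Para.detD (prFA κ Φ t p D g f).A (prFA κ Φ t p D g f).n (prFA κ Φ t p D g f).h (prFA κ Φ t p D g f).vα (prFA κ Φ t p D g f).vβ :=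
  rfl

/-- `0 < prFA.c₀`, `0 < prFA.c₁`. [folklore] -/
theorem prFA_c_pos (κ : Consts) {V : Type} [DecidableEq V] [Countable V] {G : SimpleGraph V} [G.LocallyFinite] (Φ : PlanarSkeletonFrmQuasi G) (t : V) (p : unitInterval) (D : Skelφ.StepI.DataNS V) (g : ℕ) (f : ℕ) : 0 < (prFA κ Φ t p D g f).c₀ ∧ 0 < (prFA κ Φ t p D g f).c₁ := ⟨cA_pos κ Φ t p D g f 0, cA_pos κ Φ t p D g f 1⟩

/-- **THE UNIT IDENTITY AT THE RECORD**: `prFA.c₀ = A·s₀`, `prFA.c₁ = A·s₁`. [this work] -/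
theorem prFA_c_eq (κ : Consts) {V : Type} [DecidableEq V] [Countable V] {G : SimpleGraph V} [G.LocallyFinite] (Φ : PlanarSkeletonFrmQuasi G) (t : V) (p : unitInterval) (D : Skelφ.StepI.DataNS V) (g : ℕ) (f : ℕ) : (prFA κ Φ t p D g f).c₀ = (prFA κ Φ t p D g f).A * (((fcellsA κ Φ t p D g f).s 0 : ℕ) : ℤ) ∧
    (prFA κ Φ t p D g f).c₁ = (prFA κ Φ t p D g f).A * (((fcellsA κ Φ t p D g f).s 1 : ℕ) : ℤ) :=
  ⟨c_eq_A_mul_s κ Φ t p D g f 0, c_eq_A_mul_s κ Φ t p D g f 1⟩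

-- GEN-Q (R-2, captain 2026-08-27): `PlanarSkeletonFrmFrom.NegB.prFA_c_eq_twenty_r` is not in the used cone of the node top — not ported.

/-- **The (F) binders `hL0/hL1` at the record** (`c₀·L 0 + 2 ≤ D_A`, `c₁·L 1 + 2 ≤ D_A`) from `room_fcellsA_at`. [folklore] -/
theorem prFA_room (κ : Consts) {V : Type} [DecidableEq V] [Countable V] {G : SimpleGraph V} [G.LocallyFinite] (Φ : PlanarSkeletonFrmQuasi G) (t : V) (p : unitInterval) (D : Skelφ.StepI.DataNS V) (g : ℕ) (f : ℕ) (hN : EqNumL κ Φ t p D g f) :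
    (prFA κ Φ t p D g f).c₀ * (prFA κ Φ t p D g f).L 0 + 2 ≤ (prFA κ Φ t p D g f).D ∧ (prFA κ Φ t p D g f).c₁ * (prFA κ Φ t p D g f).L 1 + 2 ≤ (prFA κ Φ t p D g f).D := by
  obtain ⟨h0, h1⟩ := room_fcellsA_at κ Φ t p D g f hN
  have e0 : (prFA κ Φ t p D g f).L 0 = |Aof κ| * (|vβL κ Φ t p D g f| + |vL κ Φ t p D g f|) := by
    unfold Skelφ.FinePrm.L Skelφ.FinePrm.lvGen
    simp only [if_true, Matrix.cons_val_zero, Matrix.cons_val_one]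
    rw [add_comm]; rfl
  have e1 : (prFA κ Φ t p D g f).L 1 = |Aof κ| * (|(nL κ Φ t p D g f : ℤ)| + |hL κ Φ t p D g f|) := by
    unfold Skelφ.FinePrm.L Skelφ.FinePrm.lvGen
    simp only [show ((1 : Fin 2) = 0) = False from propext ⟨fun h => absurd h (by decide), False.elim⟩, if_false, Matrix.cons_val_zero, Matrix.cons_val_one]
    rfl
  rw [e0, e1]
  exact ⟨h0, h1⟩

/-! ## §2 The linear column bound at the staggered centre -/

export PlanarSkeletonFrm.NegB (abs_rep₂_le_of_abs_le)

-- GEN-Q (R-2, captain 2026-08-27): `PlanarSkeletonFrmFrom.NegB.abs_cenS_le` is not in the used cone of the node top — not ported.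

-- GEN-Q (R-2, captain 2026-08-27): `PlanarSkeletonFrmFrom.NegB.NrepA_cenS_le` is not in the used cone of the node top — not ported.

/-- **THE COLUMN CONSTANT OF RECORD OF THE N2 CHAIN** `cOffS := 2·cOffA = 2·A·(ℓ_L + 21·n_L + 1)` (`≥ A·(L̂₁ + L̂₀)`). [this work] -/
def cOffS (κ : Consts) {V : Type} [DecidableEq V] [Countable V] {G : SimpleGraph V} [G.LocallyFinite] (Φ : PlanarSkeletonFrmQuasi G) (t : V) (p : unitInterval) (D : Skelφ.StepI.DataNS V) (g : ℕ) (f : ℕ) : ℕ := 2 * (20 * Neg.K κ * (ℓL κ Φ t p D g f + 21 * nL κ Φ t p D g f + 1))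

/-- `cOffS` as an integer: `2·A·(ℓ_L + 21 n_L + 1)`. [folklore] -/
theorem cOffS_int (κ : Consts) {V : Type} [DecidableEq V] [Countable V] {G : SimpleGraph V} [G.LocallyFinite] (Φ : PlanarSkeletonFrmQuasi G) (t : V) (p : unitInterval) (D : Skelφ.StepI.DataNS V) (g : ℕ) (f : ℕ) : (cOffS κ Φ t p D g f : ℤ) = 2 * (Aof κ * ((ℓL κ Φ t p D g f : ℤ) + 21 * nL κ Φ t p D g f + 1)) := by
  unfold cOffS; rw [Aof_eq_K]; push_cast; ring

-- GEN-Q (R-2, captain 2026-08-27): `PlanarSkeletonFrmFrom.NegB.offNS_le` is not in the used cone of the node top — not ported.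

-- GEN-Q (R-2, captain 2026-08-27): `PlanarSkeletonFrmFrom.NegB.hoffNS_at` is not in the used cone of the node top — not ported.

end Sched

end NegB

end PlanarSkeletonFrmQuasi

end Summit.CriticalPhenomena.PercolationContinuityZ3.Theorems.Transplant

end
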